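import Summits.Ventures.PercRepro.CatHLocal

/-!
# Branch catalogues — the H-events are reachability on the terminals (module 5)

In mode `μ`, an H-walk between two terminals avoiding `X` is a chain of within-branch detours
(`hConnAvoid_iff_hchain`, landed); each detour through a branch is the local fact `Dloc` of its
state (`hConnAvoidIn_cen_iff_Dloc`).  Hence every H-event of the gadget is `reach4` of the
4 × 4 Boolean matrix `catMat μ X d` — «both terminals avoid `X` and some branch carries the
detour» — where `d i j` records whether some branch carries the detour `(i, j)`
(`hConnAvoid_cen_iff_reach4`), and the three events of the theorem are the three instances
`event_o1_iff`, `event_o2_iff`, `event_bad_iff`.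
-/

namespace PercRepro.CatGraph

open MultiGraph StarGadgetGraph

section Generic

variable {α : Type*}

/-- Two relations agreeing off the diagonal have the same reflexive-transitive closure. -/
theorem reflTransGen_congr_offdiag {r r' : α → α → Prop} (h : ∀ x y, x ≠ y → (r x y ↔ r' x y))
    (a b : α) : Relation.ReflTransGen r a b ↔ Relation.ReflTransGen r' a b := by
  have key : ∀ {r r' : α → α → Prop}, (∀ x y, x ≠ y → (r x y → r' x y)) →
      ∀ {a b : α}, Relation.ReflTransGen r a b → Relation.ReflTransGen r' a b := by
    intro r r' h a b hab
    induction hab with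
    | refl => exact Relation.ReflTransGen.refl
    | @tail x y _ hxy ih =>
      by_cases hxy' : x = y
      · subst hxy'; exact ih
      · exact ih.tail (h x y hxy' hxy)
  exact ⟨key fun x y hne => (h x y hne).1, key fun x y hne => (h x y hne).2⟩

end Generic

variable {C : Type} {BV BE : C → Type} {m : C → ℕ} (loc : ∀ τ, MultiGraph (Fin 4 ⊕ BV τ) (BE τ))

/-- `cen` is injective. -/
theorem cen_injective : Function.Injective (cen : Fin 4 → CV BV m) := Sum.inl_injective

/-- A terminal lies in the range of `cen`. -/
theorem mem_range_cen_of_mem_cen {t : CV BV m} (ht : t ∈ Cen BV m) :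
    t ∈ Set.range (cen : Fin 4 → CV BV m) := ht

/-- A within-part H-walk through the part `none` goes nowhere. -/
theorem hConnAvoidIn_none_eq (S : Config (CE BE m)) (X : Set (CV BV m)) {u v : CV BV m}
    (h : (catGadget loc m).HConnAvoidIn S (vm 2) pe none X u v) : u = v := by
  unfold HConnAvoidIn at h
  induction h with
  | refl => rfl
  | tail _ hxy ih => exact ih.trans ((hAdjIn_none_iff loc S _ _).1 hxy.1).1

/-- `HConn` is `HConnAvoid` with nothing avoided. -/
theorem hConn_iff_hConnAvoid_empty (S : Config (CE BE m)) (c u v : CV BV m) :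
    (catGadget loc m).HConn S c u v ↔ (catGadget loc m).HConnAvoid S c ∅ u v := by
  constructor
  · intro h
    induction h with
    | refl => exact Relation.ReflTransGen.refl
    | tail _ hxy ih => exact ih.tail ⟨hxy, Set.notMem_empty _, Set.notMem_empty _⟩
  · intro h
    induction h with
    | refl => exact Relation.ReflTransGen.refl
    | tail _ hxy ih => exact ih.tail hxy.1

/-- **A terminal in the cluster of a mark**: in mode `μ`, the terminal `i` lies in the cluster of
the mark `m'` iff it is that mark, or it is the centre and `μ = some m'`. -/
theorem cen_mem_cluster_vm_iff {μ : Mode} {S : Config (CE BE m)} (hμ : InMode loc μ S)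
    (m' : Fin 3) (i : Fin 4) :
    (cen i : CV BV m) ∈ (catGadget loc m).cluster S (vm m') ↔
      i = m'.castSucc ∨ (i = 3 ∧ μ = some m') := by
  rw [mem_cluster, conn_vm_iff_parts loc hμ.1 m']
  -- a part connecting the mark to the terminal
  have h1 : (∃ p, (catGadget loc m).ConnIn S pe p (vm m') (cen i)) ↔
      i = m'.castSucc ∨ (i = 3 ∧ μ = some m') := by
    constructor
    · rintro ⟨p, hp⟩
      rcases p with _ | b
      · exact Or.inl (Sum.inl_injective ((connIn_none_iff loc S _ _).1 hp)).symm
      · have hc := (connIn_iff_loc loc S b (.inl m'.castSucc) (.inl i)).1 hp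
        rcases Fin.eq_castSucc_or_eq_last i with ⟨k, rfl⟩ | rfl
        · by_contra hne
          exact localBot_of_inMode loc hμ b m' k (fun h => hne (Or.inl (by rw [h]))) hc
        · exact Or.inr ⟨rfl, eq_some_of_attTo loc hμ (b := b) hc⟩
    · rintro (rfl | ⟨rfl, hμ'⟩)
      · exact ⟨none, (connIn_none_iff loc S _ _).2 rfl⟩
      · obtain ⟨b, hb⟩ := (hμ.2 m').2 hμ'
        exact ⟨some b, (connIn_vm_vx_iff loc S b m').2 hb⟩
  -- the centre attaches to the mark and a part connects the centre to the terminal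
  have h2 : (AttG loc S m' ∧ ∃ p, (catGadget loc m).ConnIn S pe p vx (cen i)) ↔
      μ = some m' ∧ (i = m'.castSucc ∨ i = 3) := by
    constructor
    · rintro ⟨hA, p, hp⟩
      refine ⟨(hμ.2 m').1 hA, ?_⟩
      rcases p with _ | b
      · exact Or.inr (Sum.inl_injective ((connIn_none_iff loc S _ _).1 hp)).symm
      · have hc := (connIn_iff_loc loc S b (.inl 3) (.inl i)).1 hp
        rcases Fin.eq_castSucc_or_eq_last i with ⟨k, rfl⟩ | rfl
        · have hk : attTo loc b.1 (brState S b) k := hc.symm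
          have h1 := eq_some_of_attTo loc hμ hk
          rw [(hμ.2 m').1 hA] at h1
          exact Or.inl (by rw [Option.some.inj h1])
        · exact Or.inr rfl
    · rintro ⟨hμ', h | h⟩
      · obtain ⟨b, hb⟩ := (hμ.2 m').2 hμ'
        refine ⟨⟨b, hb⟩, some b, ?_⟩
        rw [h]
        exact (connIn_iff_loc loc S b (.inl 3) (.inl m'.castSucc)).2 hb.symm
      · exact ⟨(hμ.2 m').2 hμ', none, (connIn_none_iff loc S _ _).2 (by rw [h]; rfl)⟩
  rw [h1, h2]
  constructor
  · rintro ((h | h) | ⟨hμ', h | h⟩)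
    · exact Or.inl h
    · exact Or.inr h
    · exact Or.inl h
    · exact Or.inr ⟨h, hμ'⟩
  · rintro (h | h)
    · exact Or.inl (Or.inl h)
    · exact Or.inl (Or.inr h)

/-- A terminal avoids `X` iff `nx`. -/
theorem cen_not_mem_Xset_iff {μ : Mode} {S : Config (CE BE m)} (hμ : InMode loc μ S)
    (X : Option (Fin 3)) (i : Fin 4) : (cen i : CV BV m) ∉ Xset loc S X ↔ nx X μ i = true := by
  rcases X with _ | m'
  · simp [Xset, nx]
  · simp only [Xset, nx, Option.some.injEq, forall_eq', decide_eq_true_eq]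
    rw [cen_mem_cluster_vm_iff loc hμ]

/-- The contracted H-adjacency on the terminals in mode `μ` avoiding `X`: both terminals avoid `X`
and some branch carries the detour (`d`). -/
def catMat (μ : Mode) (X : Option (Fin 3)) (d : Fin 4 → Fin 4 → Bool) (i j : Fin 4) : Bool :=
  nx X μ i && nx X μ j && d i j

/-- **A step of the H-join between distinct terminals**: both avoid `X` and some branch carries the
detour. -/
theorem hJoinStep_cen_iff {μ : Mode} {S : Config (CE BE m)} (hμ : InMode loc μ S)
    (X : Option (Fin 3)) (i j : Fin 4) (hij : i ≠ j) :
    (catGadget loc m).HJoinStep S (vm 2) pe (Cen BV m) (Xset loc S X) (cen i) (cen j) ↔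
      nx X μ i = true ∧ nx X μ j = true ∧ ∃ b : Br m, Dloc loc μ b.1 X i j (brState S b) := by
  unfold HJoinStep
  simp only [cen_mem_cen, true_and, cen_not_mem_Xset_iff loc hμ]
  refine and_congr_right fun _ => and_congr_right fun _ => ?_
  constructor
  · rintro ⟨p, hp⟩
    rcases p with _ | b
    · exact absurd (cen_injective (hConnAvoidIn_none_eq loc S _ hp)) hij
    · exact ⟨b, (hConnAvoidIn_cen_iff_Dloc loc hμ X b i j).1 hp⟩
  · rintro ⟨b, hb⟩
    exact ⟨some b, (hConnAvoidIn_cen_iff_Dloc loc hμ X b i j).2 hb⟩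

section Local

variable [∀ τ, Fintype (BV τ)] [∀ τ, DecidableEq (BV τ)] [∀ τ, Fintype (BE τ)]

/-- Within-branch H-walks avoiding `X` are symmetric. -/
theorem hconnAvoidLoc_symm (μ : Mode) (τ : C) (X : Option (Fin 3)) (s : BE τ → Bool)
    {u v : Fin 4 ⊕ BV τ} (h : hconnAvoidLoc loc μ τ X s u v) : hconnAvoidLoc loc μ τ X s v u := by
  unfold hconnAvoidLoc at h ⊢
  induction h with
  | refl => exact Relation.ReflTransGen.refl
  | tail _ hxy ih =>
    exact Relation.ReflTransGen.head ⟨hadjLoc_symm loc μ τ s hxy.1, hxy.2.2, hxy.2.1⟩ ih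

/-- The detour facts are symmetric. -/
theorem Dloc_symm (μ : Mode) (τ : C) (X : Option (Fin 3)) (i j : Fin 4) (s : BE τ → Bool)
    (h : Dloc loc μ τ X i j s) : Dloc loc μ τ X j i s :=
  hconnAvoidLoc_symm loc μ τ X s h

/-- **H-connectivity between terminals is `reach4` of `catMat`**, given the detour facts `d`. -/
theorem hConnAvoid_cen_iff_reach4 {μ : Mode} {S : Config (CE BE m)} (hμ : InMode loc μ S)
    (X : Option (Fin 3)) (d : Fin 4 → Fin 4 → Bool)
    (hd : ∀ i j, i ≠ j → ((∃ b : Br m, Dloc loc μ b.1 X i j (brState S b)) ↔ d i j = true))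
    (i j : Fin 4) :
    (catGadget loc m).HConnAvoid S (vm 2) (Xset loc S X) (cen i) (cen j) ↔
      reach4 (catMat μ X d) i j := by
  rw [(catGadget loc m).hConnAvoid_iff_hchain S (vm 2) pe br (Cen BV m) (Xset loc S X)
    (hpart loc m) (xset_closed loc S X) (cen_mem_cen i) (cen_mem_cen j)]
  rw [reflTransGen_comap_iff' cen cen_injective _
    (fun x y hxy _ => ⟨mem_range_cen_of_mem_cen hxy.1, mem_range_cen_of_mem_cen hxy.2.1⟩)]
  have hoff : ∀ i j : Fin 4, i ≠ j →
      ((catGadget loc m).HJoinStep S (vm 2) pe (Cen BV m) (Xset loc S X) (cen i) (cen j) ↔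
        catMat μ X d i j = true) := by
    intro i j hij
    rw [hJoinStep_cen_iff loc hμ X i j hij, hd i j hij]
    simp only [catMat, Bool.and_eq_true, and_assoc]
  rw [reflTransGen_congr_offdiag hoff]
  have hsym : ∀ i j : Fin 4, catMat μ X d i j = true → catMat μ X d j i = true := by
    intro i j h
    by_cases hij : i = j
    · subst hij; exact h
    · simp only [catMat, Bool.and_eq_true] at h ⊢
      obtain ⟨⟨hi, hj⟩, hdij⟩ := h
      obtain ⟨b, hb⟩ := (hd i j hij).2 hdij
      exact ⟨⟨hj, hi⟩, (hd j i (Ne.symm hij)).1 ⟨b, Dloc_symm loc μ b.1 X i j _ hb⟩⟩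
  rw [reflTransGen_iff_reachable_fromRel hsym]
  exact Iff.rfl

/-- **The event `o1`** (`c ~_H a` avoiding the cluster of `b`) is `reach4` of `catMat μ (some 1) d`
from `c = 2` to `a = 0`. -/
theorem event_o1_iff {μ : Mode} {S : Config (CE BE m)} (hμ : InMode loc μ S)
    (d : Fin 4 → Fin 4 → Bool)
    (hd : ∀ i j, i ≠ j → ((∃ b : Br m, Dloc loc μ b.1 (some 1) i j (brState S b)) ↔ d i j = true)) :
    (catGadget loc m).HConnAvoid S (vm 2) ((catGadget loc m).cluster S (vm 1)) (vm 2) (vm 0) ↔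
      reach4 (catMat μ (some 1) d) 2 0 :=
  hConnAvoid_cen_iff_reach4 loc hμ (some 1) d hd 2 0

/-- **The event `o2`** (`c ~_H b` avoiding the cluster of `a`) is `reach4` of `catMat μ (some 0) d`
from `c = 2` to `b = 1`. -/
theorem event_o2_iff {μ : Mode} {S : Config (CE BE m)} (hμ : InMode loc μ S)
    (d : Fin 4 → Fin 4 → Bool)
    (hd : ∀ i j, i ≠ j → ((∃ b : Br m, Dloc loc μ b.1 (some 0) i j (brState S b)) ↔ d i j = true)) :
    (catGadget loc m).HConnAvoid S (vm 2) ((catGadget loc m).cluster S (vm 0)) (vm 2) (vm 1) ↔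
      reach4 (catMat μ (some 0) d) 2 1 :=
  hConnAvoid_cen_iff_reach4 loc hμ (some 0) d hd 2 1

/-- **The event `bad`** (`a ~_H b`) is `reach4` of `catMat μ none d` from `a = 0` to `b = 1`. -/
theorem event_bad_iff {μ : Mode} {S : Config (CE BE m)} (hμ : InMode loc μ S)
    (d : Fin 4 → Fin 4 → Bool)
    (hd : ∀ i j, i ≠ j → ((∃ b : Br m, Dloc loc μ b.1 none i j (brState S b)) ↔ d i j = true)) :
    (catGadget loc m).HConn S (vm 2) (vm 0) (vm 1) ↔ reach4 (catMat μ none d) 0 1 := by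
  rw [hConn_iff_hConnAvoid_empty]
  exact hConnAvoid_cen_iff_reach4 loc hμ none d hd 0 1

end Local

end PercRepro.CatGraph
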